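import Summits.HodgeConjecture.HodgeConjecture.Theses.SiuRepresentability

/-!
Skeleton line for the split child `RepresentableCupHodge` (stmt-HodgeConjecture-18156) of `KaehlerRepresentable` (stmt-HodgeConjecture-9029).
The composition concludes the ROUTE DECL by name (Theses/SiuRepresentability.lean rev 10).
-/


/-!
## Birth skeleton of the piece `RepresentableCupHodge` (decomposable sector of `KaehlerRepresentable`)

Line `decomposable-sector`: two registered stubs and the kernel-checked composition
`RepresentableCupHodge_of : stub_siuTransfer → stub_algebraicCupHodge → RepresentableCupHodge`.
-/

namespace Summit.HodgeConjecture.HodgeConjecture.Cruxes.KaehlerRepresentable.DecomposableSector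

open scoped Manifold ContinuousMap
open Summit.HodgeConjecture.HodgeConjecture.Theses.SiuRepresentability

/-- STUB 1 (= the route's support item `SiuTransfer`, stmt-HodgeConjecture-9028, a theorem in print:
Siu 1980 Thm. 1 + Eells–Sampson 1964 + Remmert–Chow): on a compact ball quotient a Kähler-representable
class of codimension `i` with `n - i ≥ 2` is algebraic. [cite: Siu1980, Thm. 1] -/
theorem stub_siuTransfer : SiuTransfer := by
  sorry

/-- STUB 2 (hereditary supply, the open content of the piece): on a compact ball quotient the cup
product of an ALGEBRAIC class of codimension `i ≥ 1` with a rational Hodge `(j,j)`-class, `j ≥ 1`,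
`i + j = p ≤ n/2`, lies in the span of the Kähler-representable classes of codimension `p`
(`cl(Z) ∪ b = g_!(g^* b)`: Kähler–Steenrod supply for the restrictions of Hodge classes to the
resolved subvarieties `Z̃ → Z ⊂ X`; implied by the Hodge conjecture on the `Z̃` + Hironaka).
[cite: VoisinHodgeII2003, §9.2.4 Prop. 9.20] -/
theorem stub_algebraicCupHodge :
    ∀ ⦃n : ℕ⦄ ⦃X : Literature.AlgebraicGeometry.Motives.SchemeOver ℂ⦄ (hX : Literature.AlgebraicGeometry.Motives.IsSmoothProjective n X), (∃ (A : Literature.AlgebraicGeometry.HodgeTheory.HodgeModel n X) (π : EuclideanSpace ℂ (Fin n) → A.carrier), (∀ z ∈ Metric.ball (0 : EuclideanSpace ℂ (Fin n)) 1, MDifferentiableAt 𝓘(ℂ, EuclideanSpace ℂ (Fin n)) 𝓘(ℂ, A.model) π z) ∧ IsCoveringMap ((Metric.ball (0 : EuclideanSpace ℂ (Fin n)) 1).restrict π)) → ∀ (i j p k : ℕ) (hij : i + j = p) (hpk : p + k = n), 1 ≤ i → 1 ≤ j → 2 * p ≤ n → ∀ a : Literature.AlgebraicGeometry.HodgeTheory.complexBetti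 X (2 * i), a ∈ Literature.AlgebraicGeometry.HodgeTheory.algebraicClasses X i → ∀ b : Literature.AlgebraicGeometry.HodgeTheory.complexBetti X (2 * j), Literature.AlgebraicGeometry.HodgeTheory.IsRationalClass b → Literature.AlgebraicGeometry.HodgeTheory.IsOfHodgeType n X (2 * j) j j b → Literature.AlgebraicTopology.SingularHomology.cupProduct (show 2 * i + 2 * j = 2 * p by omega) a b ∈ Submodule.span ℂ {c' : Literature.AlgebraicGeometry.HodgeTheory.complexBetti X (2 * p) | ∃ (μX : Literature.AlgebraicTopology.SingularHomology.HomologicalOrientation ℂ (Literature.AlgebraicGeometry.Motives.ComplexPoints X) (2 * n)) (M : Literature.AlgebraicGeometry.Motives.SchemeOver ℂ) (_ : Literature.AlgebraicGeometry.Motives.IsSmoothProjective k M) (μM : Literature.AlgebraicTopology.SingularHomology.HomologicalOrientation ℂ (Literature.AlgebraicGeometry.Motives.ComplexPoints M) (2 * k)) (f : C(Literature.AlgebraicGeometry.Motives.ComplexPoints M, Literature.AlgebraicGeometry.Motives.ComplexPoints X)), Literature.AlgebraicTopology.SingularHomology.capProduct (show 2 * p + 2 * k = 2 * n by omega) c'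 μX.fundamentalClass = Literature.AlgebraicTopology.SingularHomology.singularHomology.map ℂ ℂ f (2 * k) μM.fundamentalClass} := by
  sorry

/-- COMPOSITION (kernel-checked, no sorry; hypotheses = the two registered stubs BY NAME): Siu's
transfer (`stub_siuTransfer`) makes a Kähler-representable first factor algebraic (its codimension
`i ≤ p - 1 ≤ n/2 - 1`, so `n - i ≥ 2`), after which `stub_algebraicCupHodge` applies; an algebraic
first factor is `stub_algebraicCupHodge` directly. [cite: Siu1980, Thm. 1] -/
theorem RepresentableCupHodge_of : RepresentableCupHodge := by
  intro n X hX hB i j p ki k hij hik hpk hi hj h2p a ha b hb hhb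
  refine stub_algebraicCupHodge hX hB i j p k hij hpk hi hj h2p a ?_ b hb hhb
  rcases ha with ha | ⟨μX, M, hM, μM, f, hf⟩
  · exact ha
  · exact stub_siuTransfer hX hB i ki hik (by omega) μX M hM μM f a hf

end Summit.HodgeConjecture.HodgeConjecture.Cruxes.KaehlerRepresentable.DecomposableSector
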